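import Summits.QuantumFields.BalabanUV.T4Continuum.Support.NE7EtaCovariantJunction
import HarnessLib

/-!
# NE7EtaHolderJunction — route #1 of the NE7 crux (node U5), socket `h` AMENDMENT 5 (proposal of ROAD-G106 §4): the discrete
# Landau–Kolmogorov step of `NE7EtaCovariantJunction` with the Lipschitz hypothesis on the covariant gradient (second differences `≤ λ₂`,
# i.e. (Lip₂′ᶜ)) REPLACED by a HÖLDER modulus along the line — `‖D(y + j•e_μ) transported − D(y)‖ ≤ ω(j)` (general `ω`; `ω(j) = H√j`)

Cell `pub-balaban`, rung (B)+1 sub-cell t4, lineage `b2b-balaban-t4-ne7-p1`, generation 106 (CRUX PROVER NE7 #1 = OWNER of BINDER row NE7).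
Memo `t4/b2b-balaban-t4-ne7-p1-g106/ROAD-G106.md` §3–§4.

WHY.  The consumer of socket `h` (`NE7EtaRatesD4Cov.norm_covDiff_le_rate` → `NE7EtaCurlFromCovGradient.closeness_of_covRoot₂`) extracts the rate of
the covariant gradient of the background coordinate `Z` by Landau–Kolmogorov along lattice lines: sup `‖Z‖` (from the energy rate and (Lip₁ᶜ))
against the (Lip₂′ᶜ) bound on SECOND covariant differences at the full scale `(L^k)^{−3}` — the C^{1,1} level.  Print gives that level only
in Hölder norms: [Balaban1985RegularSpaces] Thm 2 (1.36) bounds `‖A‖_{1,β}` for `β ≤ β₀ < 1` (tree typing `B8.Thm2Printed`, "β₀ < 1 fixed"),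
the full-scale (1.39) member being the LAPLACIAN; and the tree's own potential theory records the same obstruction
(`Beta/HarmonicSecondDifference`: «with a bounded source the second differences of the potential carry a logarithm, which is why print states
the member in Hölder norms»).  This file is the consumer-side junction that makes a β-Hölder hypothesis (β = ½ in §2–§3; any modulus in §1)
sufficient: along a line the transport is exact, so no curvature enters (the reason gen 22 chose lines).
WHAT ([folklore]; 0 def, 0 sorry).
 * §1 `seq_fwdDiff_le_of_sup_of_modulus` — for `g : ℕ → E`, `‖g j‖ ≤ M`, and `‖(g (j+1) − g j) − (g 1 − g 0)‖ ≤ ω j` for `j < m` (`m ≥ 1`):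
   `‖g 1 − g 0‖ ≤ 2M∕m + (Σ_{j<m} ω j)∕m`; `sum_sqrt_range_le` — `Σ_{j<m} √j ≤ m√m`; `seq_fwdDiff_le_of_sup_of_holderHalf` — with `ω j = H√j`:
   `‖g 1 − g 0‖ ≤ 2M∕m + H√m`; `seq_fwdDiff_le_of_sup_of_holderHalf_real` — for every real `t ≥ 1` (take `m = ⌈t⌉₊`): `≤ 2M∕t + H√(t+1)`.
 * §2 `norm_covDiff_le_of_holderHalf` — THE COVARIANT HÖLDER–LANDAU–KOLMOGOROV STEP: `W` unitary, `‖Z y κ‖ ≤ M` everywhere, and along the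
   `μ`-line through `y + e κ` the covariant first differences `D(y) = Ad (W (y+e κ) μ) (Z (y+e μ) κ) − Z y κ`, transported back with the line
   holonomy `H_j = ∏_{i<j} W (y + e κ + i•e μ) μ`, satisfy `‖Ad H_j (D(y + j•e μ)) − D(y)‖ ≤ H·√j` for `j < m` ⟹ `‖D(x)‖ ≤ 2M∕m + H√m` at every `x`;
   `norm_covDiff_le_of_holderHalf_real` — the same with a real parameter `t ≥ 1` and the Hölder bound for all `j`.
 * §3 `holderHalf_of_lip2c` — (Lip₂′ᶜ) ⟹ the transported Hölder-½ hypothesis with `H = λ₂√R` for `j ≤ R` (Lipschitz ⟹ Hölder on bounded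
   ranges), so every delivery of the OLD socket is a delivery of the amended one on ranges `j ≤ R`.
HONEST FRAMING (page 1): elementary real analysis on sequences + exact line transport ([folklore]); nothing of Bałaban's asserted as an axiom;
nothing of NE3∕NE7 discharged; the AMENDMENT itself (re-typing socket `h` and re-threading the END chain) is NOT done here; spine count =
dagwriter∕referees' call; FIXED FINITE T⁴, rung (B)+1 — NOT infinite volume, NOT mass gap, NOT BetaPertH, NOT Clay.
-/

set_option autoImplicit false

open scoped BigOperators Matrix Matrix.Norms.L2Operator
open Finset

namespace Summit.QuantumFields.BalabanUV.T4Continuum.NE7EtaHolderJunction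

open Literature.MathematicalPhysics.QuantumFieldTheory.Balaban1983to89
open B7Prop1Explicit B7Prop2Explicit
open T4AveragingDeficitWall hiding Site Plane Plaq Bond
open T4AveragingDeficitNonAbelian (Ad_mul Ad_sub)
open AveragingDeficitTransport (norm_Ad_of_unitary)
open AveragingDeficitNearIdentity (Ad_one)
open NE7EtaCovariantJunction (lineHol_succ lineHol_mem_unitary seq_fwdDiff_shift_sub_le)

noncomputable section

/-! ## §1 Discrete Landau–Kolmogorov with a general modulus on the first differences -/

section SeqLK

variable {E : Type*} [NormedAddCommGroup E] [NormedSpace ℝ E]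

/-- **SEQUENCE LANDAU–KOLMOGOROV WITH A MODULUS** (two-term form): `‖g j‖ ≤ M` for all `j`, and the first differences drift from the first
one by at most `ω j` after `j < m` steps ⟹ `‖g 1 − g 0‖ ≤ 2M∕m + (Σ_{j<m} ω j)∕m` (`m ≥ 1`). [folklore] -/
theorem seq_fwdDiff_le_of_sup_of_modulus (g : ℕ → E) {M : ℝ} (hM : ∀ j, ‖g j‖ ≤ M) (ω : ℕ → ℝ) {m : ℕ} (hm : 1 ≤ m)
    (hω : ∀ j : ℕ, j < m → ‖(g (j + 1) - g j) - (g 1 - g 0)‖ ≤ ω j) :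
    ‖g 1 - g 0‖ ≤ 2 * M / m + (∑ j ∈ Finset.range m, ω j) / m := by
  set D : E := g 1 - g 0 with hD
  have htel : g m - g 0 = ∑ j ∈ Finset.range m, (g (j + 1) - g j) := (Finset.sum_range_sub g m).symm
  have hsum : ∑ j ∈ Finset.range m, (g (j + 1) - g j) = m • D + ∑ j ∈ Finset.range m, ((g (j + 1) - g j) - D) := by
    simp only [Finset.sum_sub_distrib, Finset.sum_const, Finset.card_range]; abel
  have hkey : (m : ℕ) • D = (g m - g 0) - ∑ j ∈ Finset.range m, ((g (j + 1) - g j) - D) := by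
    rw [htel, hsum]; abel
  have hn1 : ‖g m - g 0‖ ≤ 2 * M := by
    calc ‖g m - g 0‖ ≤ ‖g m‖ + ‖g 0‖ := norm_sub_le _ _
      _ ≤ M + M := add_le_add (hM _) (hM _)
      _ = 2 * M := by ring
  have hn2 : ‖∑ j ∈ Finset.range m, ((g (j + 1) - g j) - D)‖ ≤ ∑ j ∈ Finset.range m, ω j := by
    calc ‖∑ j ∈ Finset.range m, ((g (j + 1) - g j) - D)‖
        ≤ ∑ j ∈ Finset.range m, ‖(g (j + 1) - g j) - D‖ := norm_sum_le _ _
      _ ≤ ∑ j ∈ Finset.range m, ω j := Finset.sum_le_sum fun j hj => hω j (Finset.mem_range.mp hj)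
  have hmpos : (0 : ℝ) < m := by exact_mod_cast hm
  have hnorm : (m : ℝ) * ‖D‖ ≤ 2 * M + ∑ j ∈ Finset.range m, ω j := by
    have : ‖(m : ℕ) • D‖ = (m : ℝ) * ‖D‖ := by
      rw [← Nat.cast_smul_eq_nsmul ℝ, norm_smul, Real.norm_natCast]
    rw [← this, hkey]
    exact (norm_sub_le _ _).trans (add_le_add hn1 hn2)
  have : ‖D‖ ≤ (2 * M + ∑ j ∈ Finset.range m, ω j) / m := by
    rw [le_div_iff₀ hmpos]; linarith
  calc ‖g 1 - g 0‖ = ‖D‖ := rfl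
    _ ≤ (2 * M + ∑ j ∈ Finset.range m, ω j) / m := this
    _ = 2 * M / m + (∑ j ∈ Finset.range m, ω j) / m := by rw [add_div]

omit [NormedSpace ℝ E] in
/-- `Σ_{j<m} √j ≤ m·√m`. [folklore] -/
theorem sum_sqrt_range_le (m : ℕ) : ∑ j ∈ Finset.range m, Real.sqrt (j : ℝ) ≤ (m : ℝ) * Real.sqrt (m : ℝ) := by
  calc ∑ j ∈ Finset.range m, Real.sqrt (j : ℝ) ≤ ∑ j ∈ Finset.range m, Real.sqrt (m : ℝ) :=
        Finset.sum_le_sum fun j hj => Real.sqrt_le_sqrt (by exact_mod_cast (Finset.mem_range.mp hj).le)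
    _ = (m : ℝ) * Real.sqrt (m : ℝ) := by rw [Finset.sum_const, Finset.card_range, nsmul_eq_mul]

/-- **SEQUENCE HÖLDER-½–LANDAU–KOLMOGOROV** (two-term form): `‖g j‖ ≤ M`, the first differences are Hölder-½ from the origin with constant
`H ≥ 0` on the range `j < m` ⟹ `‖g 1 − g 0‖ ≤ 2M∕m + H√m`. [folklore] -/
theorem seq_fwdDiff_le_of_sup_of_holderHalf (g : ℕ → E) {M H : ℝ} (hH : 0 ≤ H) (hM : ∀ j, ‖g j‖ ≤ M) {m : ℕ} (hm : 1 ≤ m)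
    (hω : ∀ j : ℕ, j < m → ‖(g (j + 1) - g j) - (g 1 - g 0)‖ ≤ H * Real.sqrt (j : ℝ)) :
    ‖g 1 - g 0‖ ≤ 2 * M / m + H * Real.sqrt (m : ℝ) := by
  have h := seq_fwdDiff_le_of_sup_of_modulus g hM (fun j => H * Real.sqrt (j : ℝ)) hm hω
  have hmpos : (0 : ℝ) < m := by exact_mod_cast hm
  have hs : (∑ j ∈ Finset.range m, H * Real.sqrt (j : ℝ)) / m ≤ H * Real.sqrt (m : ℝ) := by
    rw [← Finset.mul_sum, div_le_iff₀ hmpos]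
    have := mul_le_mul_of_nonneg_left (sum_sqrt_range_le m) hH
    linarith
  linarith

/-- **REAL-PARAMETER FORM**: if the Hölder-½ bound holds for all `j`, then for every real `t ≥ 1`, `‖g 1 − g 0‖ ≤ 2M∕t + H√(t + 1)`
(take `m = ⌈t⌉₊`, `t ≤ m < t + 1`; `M ≥ 0`). [folklore] -/
theorem seq_fwdDiff_le_of_sup_of_holderHalf_real (g : ℕ → E) {M H : ℝ} (hM0 : 0 ≤ M) (hH : 0 ≤ H) (hM : ∀ j, ‖g j‖ ≤ M)
    (hω : ∀ j : ℕ, ‖(g (j + 1) - g j) - (g 1 - g 0)‖ ≤ H * Real.sqrt (j : ℝ)) {t : ℝ} (ht : 1 ≤ t) :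
    ‖g 1 - g 0‖ ≤ 2 * M / t + H * Real.sqrt (t + 1) := by
  set m : ℕ := ⌈t⌉₊ with hm
  have ht0 : 0 < t := by linarith
  have hm1 : 1 ≤ m := Nat.one_le_iff_ne_zero.mpr (Nat.pos_iff_ne_zero.mp (Nat.ceil_pos.mpr ht0))
  have hmge : t ≤ (m : ℝ) := Nat.le_ceil t
  have hmlt : (m : ℝ) < t + 1 := Nat.ceil_lt_add_one ht0.le
  have h := seq_fwdDiff_le_of_sup_of_holderHalf g hH hM hm1 (fun j _ => hω j)
  have hmpos : (0 : ℝ) < m := by exact_mod_cast hm1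
  have h1 : 2 * M / (m : ℝ) ≤ 2 * M / t := div_le_div_of_nonneg_left (by positivity) ht0 hmge
  have h2 : H * Real.sqrt (m : ℝ) ≤ H * Real.sqrt (t + 1) := mul_le_mul_of_nonneg_left (Real.sqrt_le_sqrt hmlt.le) hH
  linarith

end SeqLK

/-! ## §2 The covariant Hölder–Landau–Kolmogorov step along a lattice line -/

section Transport

variable {d : ℕ} {n : Type*} [Fintype n] [DecidableEq n]

/-- **THE COVARIANT HÖLDER-½–LANDAU–KOLMOGOROV STEP.**  `W` unitary; `‖Z y κ‖ ≤ M` for all `y`; along the `μ`-line through `y + e κ`, with the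
line holonomy `H_j(y) = ∏_{i<j} W (y + e κ + i•e μ) μ` and the covariant first differences `D(y) = Ad (W (y + e κ) μ) (Z (y + e μ) κ) − Z y κ`,
the TRANSPORTED HÖLDER-½ condition `‖Ad (H_j(y)) (D(y + j•e μ)) − D(y)‖ ≤ Hc·√j` for all `y` and all `j < m` (`m ≥ 1`, `Hc ≥ 0`).  Then
`‖D(x)‖ ≤ 2M∕m + Hc√m` at every `x`.  Proof: transport `Z (x + j•e μ) κ` back to the base with `H_j(x)`; the transported sequence has norms
`= ‖Z‖` and first-difference drift `= Ad (H_j)`(covariant drift); apply §1. [folklore] -/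
theorem norm_covDiff_le_of_holderHalf {W : Site d → Fin d → (Matrix n n ℂ)ˣ} (hW : IsUnitaryCfg W)
    {Z : Site d → Fin d → Matrix n n ℂ} (κ μ : Fin d) {M Hc : ℝ} (hHc : 0 ≤ Hc) (hM : ∀ y, ‖Z y κ‖ ≤ M) {m : ℕ} (hm : 1 ≤ m)
    (hHol : ∀ (y : Site d) (j : ℕ), j < m →
      ‖Ad (((List.range j).map fun i : ℕ => W (y + e κ + i • e μ) μ).prod)
            (Ad (W (y + j • e μ + e κ) μ) (Z (y + j • e μ + e μ) κ) - Z (y + j • e μ) κ)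
          - (Ad (W (y + e κ) μ) (Z (y + e μ) κ) - Z y κ)‖ ≤ Hc * Real.sqrt (j : ℝ))
    (x : Site d) :
    ‖Ad (W (x + e κ) μ) (Z (x + e μ) κ) - Z x κ‖ ≤ 2 * M / m + Hc * Real.sqrt (m : ℝ) := by
  -- the line through the base b = x + e κ, the transported sequence g
  set b : Site d := x + e κ with hb
  set H : ℕ → (Matrix n n ℂ)ˣ := fun j => ((List.range j).map fun i : ℕ => W (b + i • e μ) μ).prod with hH
  have hH0 : H 0 = 1 := by simp [hH]
  have hHs : ∀ j, H (j + 1) = H j * W (b + j • e μ) μ := fun j => lineHol_succ W b μ j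
  have hHu : ∀ j, H j ∈ unitaryUnits (Matrix n n ℂ) := fun j => lineHol_mem_unitary hW b μ j
  set g : ℕ → Matrix n n ℂ := fun j => Ad (H j) (Z (x + j • e μ) κ) with hg
  -- site bookkeeping
  have eb : ∀ j : ℕ, x + j • e μ + e κ = b + j • e μ := fun j => by rw [hb]; abel
  have es : ∀ j : ℕ, x + j • e μ + e μ = x + (j + 1) • e μ := fun j => by rw [add_assoc, ← succ_nsmul]
  -- forward differences of g are transported covariant differences
  have hdiff : ∀ j : ℕ, g (j + 1) - g j = Ad (H j) (Ad (W (b + j • e μ) μ) (Z (x + (j + 1) • e μ) κ) - Z (x + j • e μ) κ) := by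
    intro j
    simp only [hg]
    rw [hHs, Ad_mul, Ad_sub]
  have e1 : g 1 - g 0 = Ad (W (x + e κ) μ) (Z (x + e μ) κ) - Z x κ := by
    rw [show (1 : ℕ) = 0 + 1 by rfl, hdiff 0, hH0, Ad_one]
    simp [hb]
  -- norms
  have hgn : ∀ j, ‖g j‖ ≤ M := fun j => by
    simp only [hg]; rw [norm_Ad_of_unitary (hHu j)]; exact hM _
  have hgω : ∀ j : ℕ, j < m → ‖(g (j + 1) - g j) - (g 1 - g 0)‖ ≤ Hc * Real.sqrt (j : ℝ) := by
    intro j hj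
    rw [hdiff j, e1]
    have h := hHol x j hj
    rw [eb j, es j] at h
    exact h
  have h := seq_fwdDiff_le_of_sup_of_holderHalf g hHc hgn hm hgω
  rw [e1] at h
  exact h

/-- **REAL-PARAMETER FORM OF THE COVARIANT STEP**: the transported Hölder-½ condition for all `y, j`, `M ≥ 0` ⟹ for every real `t ≥ 1`,
`‖D(x)‖ ≤ 2M∕t + Hc√(t + 1)`. [folklore] -/
theorem norm_covDiff_le_of_holderHalf_real {W : Site d → Fin d → (Matrix n n ℂ)ˣ} (hW : IsUnitaryCfg W)
    {Z : Site d → Fin d → Matrix n n ℂ} (κ μ : Fin d) {M Hc : ℝ} (hM0 : 0 ≤ M) (hHc : 0 ≤ Hc) (hM : ∀ y, ‖Z y κ‖ ≤ M)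
    (hHol : ∀ (y : Site d) (j : ℕ),
      ‖Ad (((List.range j).map fun i : ℕ => W (y + e κ + i • e μ) μ).prod)
            (Ad (W (y + j • e μ + e κ) μ) (Z (y + j • e μ + e μ) κ) - Z (y + j • e μ) κ)
          - (Ad (W (y + e κ) μ) (Z (y + e μ) κ) - Z y κ)‖ ≤ Hc * Real.sqrt (j : ℝ))
    {t : ℝ} (ht : 1 ≤ t) (x : Site d) :
    ‖Ad (W (x + e κ) μ) (Z (x + e μ) κ) - Z x κ‖ ≤ 2 * M / t + Hc * Real.sqrt (t + 1) := by
  set m : ℕ := ⌈t⌉₊ with hm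
  have ht0 : 0 < t := by linarith
  have hm1 : 1 ≤ m := Nat.one_le_iff_ne_zero.mpr (Nat.pos_iff_ne_zero.mp (Nat.ceil_pos.mpr ht0))
  have hmge : t ≤ (m : ℝ) := Nat.le_ceil t
  have hmlt : (m : ℝ) < t + 1 := Nat.ceil_lt_add_one ht0.le
  have h := norm_covDiff_le_of_holderHalf hW κ μ hHc hM hm1 (fun y j _ => hHol y j) x
  have h1 : 2 * M / (m : ℝ) ≤ 2 * M / t := div_le_div_of_nonneg_left (by positivity) ht0 hmge
  have h2 : Hc * Real.sqrt (m : ℝ) ≤ Hc * Real.sqrt (t + 1) := mul_le_mul_of_nonneg_left (Real.sqrt_le_sqrt hmlt.le) hHc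
  linarith

/-! ## §3 The old hypothesis implies the new one on bounded ranges -/

/-- **(Lip₂′ᶜ) ⟹ TRANSPORTED HÖLDER-½ ON RANGES `j ≤ R`**: if the covariant SECOND differences along the `μ`-line are `≤ λ₂` everywhere
(`λ₂ ≥ 0`), then the transported drift of the first differences after `j` steps is `≤ j·λ₂ ≤ λ₂√R·√j` for `j ≤ R`.  So every delivery of the
Lipschitz socket is a delivery of the Hölder-½ socket with `Hc = λ₂√R` on that range. [folklore] -/
theorem holderHalf_of_lip2c {W : Site d → Fin d → (Matrix n n ℂ)ˣ} (hW : IsUnitaryCfg W) {Z : Site d → Fin d → Matrix n n ℂ}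
    (κ μ : Fin d) {lam2 : ℝ} (hl0 : 0 ≤ lam2)
    (h2 : ∀ y : Site d, ‖Ad (W (y + e κ) μ) (Ad (W (y + e κ + e μ) μ) (Z (y + (2 : ℕ) • e μ) κ) - Z (y + e μ) κ)
        - (Ad (W (y + e κ) μ) (Z (y + e μ) κ) - Z y κ)‖ ≤ lam2)
    (R : ℕ) (y : Site d) (j : ℕ) (hj : j ≤ R) :
    ‖Ad (((List.range j).map fun i : ℕ => W (y + e κ + i • e μ) μ).prod)
          (Ad (W (y + j • e μ + e κ) μ) (Z (y + j • e μ + e μ) κ) - Z (y + j • e μ) κ)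
        - (Ad (W (y + e κ) μ) (Z (y + e μ) κ) - Z y κ)‖ ≤ lam2 * Real.sqrt (R : ℝ) * Real.sqrt (j : ℝ) := by
  -- the transported sequence along the line through b = y + e κ
  set b : Site d := y + e κ with hb
  set H : ℕ → (Matrix n n ℂ)ˣ := fun j => ((List.range j).map fun i : ℕ => W (b + i • e μ) μ).prod with hH
  have hH0 : H 0 = 1 := by simp [hH]
  have hHs : ∀ j, H (j + 1) = H j * W (b + j • e μ) μ := fun j => lineHol_succ W b μ j
  have hHu : ∀ j, H j ∈ unitaryUnits (Matrix n n ℂ) := fun j => lineHol_mem_unitary hW b μ j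
  set g : ℕ → Matrix n n ℂ := fun j => Ad (H j) (Z (y + j • e μ) κ) with hg
  have eb : ∀ j : ℕ, y + j • e μ + e κ = b + j • e μ := fun j => by rw [hb]; abel
  have es : ∀ j : ℕ, y + j • e μ + e μ = y + (j + 1) • e μ := fun j => by rw [add_assoc, ← succ_nsmul]
  have es2 : ∀ j : ℕ, y + j • e μ + (2 : ℕ) • e μ = y + (j + 2) • e μ := fun j => by rw [add_assoc, ← add_nsmul]
  have ebs : ∀ j : ℕ, b + j • e μ + e μ = b + (j + 1) • e μ := fun j => by rw [add_assoc, ← succ_nsmul]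
  have hdiff : ∀ j : ℕ, g (j + 1) - g j = Ad (H j) (Ad (W (b + j • e μ) μ) (Z (y + (j + 1) • e μ) κ) - Z (y + j • e μ) κ) := by
    intro j
    simp only [hg]
    rw [hHs, Ad_mul, Ad_sub]
  have hdiff2 : ∀ j : ℕ, (g (j + 2) - g (j + 1)) - (g (j + 1) - g j)
      = Ad (H j) (Ad (W (b + j • e μ) μ) (Ad (W (b + (j + 1) • e μ) μ) (Z (y + (j + 2) • e μ) κ) - Z (y + (j + 1) • e μ) κ)
          - (Ad (W (b + j • e μ) μ) (Z (y + (j + 1) • e μ) κ) - Z (y + j • e μ) κ)) := by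
    intro j
    rw [hdiff j, show j + 2 = (j + 1) + 1 by ring, hdiff (j + 1), hHs j, Ad_mul, ← Ad_sub]
  have hg2 : ∀ j : ℕ, ‖(g (j + 2) - g (j + 1)) - (g (j + 1) - g j)‖ ≤ lam2 := by
    intro j
    rw [hdiff2 j, norm_Ad_of_unitary (hHu j)]
    have h := h2 (y + j • e μ)
    rw [eb j, ebs j, es j, es2 j] at h
    exact h
  have e1 : g 1 - g 0 = Ad (W (y + e κ) μ) (Z (y + e μ) κ) - Z y κ := by
    rw [show (1 : ℕ) = 0 + 1 by rfl, hdiff 0, hH0, Ad_one]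
    simp [hb]
  have hdrift := seq_fwdDiff_shift_sub_le g hg2 j
  rw [hdiff j, e1] at hdrift
  rw [eb j, es j]
  -- `j·λ₂ ≤ λ₂√R·√j` for `j ≤ R`
  have hjR : (j : ℝ) * lam2 ≤ lam2 * Real.sqrt (R : ℝ) * Real.sqrt (j : ℝ) := by
    have hj0 : (0 : ℝ) ≤ j := by positivity
    have hsj : Real.sqrt (j : ℝ) * Real.sqrt (j : ℝ) = j := Real.mul_self_sqrt hj0
    have hle : Real.sqrt (j : ℝ) ≤ Real.sqrt (R : ℝ) := Real.sqrt_le_sqrt (by exact_mod_cast hj)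
    have h0 : 0 ≤ Real.sqrt (j : ℝ) := Real.sqrt_nonneg _
    calc (j : ℝ) * lam2 = lam2 * Real.sqrt (j : ℝ) * Real.sqrt (j : ℝ) := by rw [mul_assoc, hsj]; ring
      _ ≤ lam2 * Real.sqrt (R : ℝ) * Real.sqrt (j : ℝ) :=
          mul_le_mul_of_nonneg_right (mul_le_mul_of_nonneg_left hle hl0) h0
  exact hdrift.trans hjR

end Transport

end

end Summit.QuantumFields.BalabanUV.T4Continuum.NE7EtaHolderJunction
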